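/-
Copyright (c) 2026. All rights reserved.
Released under Apache 2.0 license as described in the file LICENSE.
Authors: abc-iut cell, wave-4 seat abc-iut-w4-d085 (L3 sub-DAG Thm 5.4, row T54-4b).
-/
import Literature.AnabelianGeometry.SemiGraphs.ArithMaximalCompact
import HarnessLib

/-!
# [SemiAnbd] Theorem 5.4 (ii), second sentence: edge-like subgroups as intersections of two verticial
# subgroups — reduction to Thm 5.4 (i), Rmk 5.3.1 and data-level inputs (sub-DAG row T54-4b)

Mochizuki, *Semi-graphs of anabelioids*, Publ. RIMS **42** (2006), §5, Theorem 5.4 p. 66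
[cite: MochizukiSemiAnbd2006, Thm 5.4 (ii), p. 66] ("The arithmetically ample intersections of two
distinct arithmetically maximal compact subgroups of `π₁^temp(𝔊)` are precisely the edge-like subgroups";
proof: "entirely parallel to the proofs of Theorem 3.7, Corollary 3.9"), over abc-iut-L3-t3's typing
`ArithMaximalCompact.lean` (data `D : DecompositionData Gtp V B`, augmentation `aug : Gtp →* PA`).

PROOF-ONLY companion (no definition, no new `Prop`). The companion `ArithMaximalCompactReductions.lean`
(row W4-18) reduces the typed statement `ArithMaximalCompactStatementII D aug` to (i), Rmk 5.3.1, the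
incomparability of verticial subgroups and the input `hEV` "every edge-like subgroup is `W₁ ⊓ W₂` for two
distinct verticial subgroups" (the arithmetic twin of `EdgeLikeIsInfVerticial`, [SemiAnbd] p. 41). At
the level of the ABSTRACT data of p. 65 — which record neither that the decomposition groups of the two
branches of one edge are conjugate, nor which vertex a verticial subgroup comes from — `hEV` is itself a
REDUCTION, proved here, to (i) + Rmk 5.3.1 and two data-level inputs stated as INLINE hypotheses:
`hβ₁` "every edge-like subgroup lies in two distinct verticial subgroups" (the hosts of the two branches
of its edge; `𝔾` an untangled graph) and `hβ₂` "nested edge-like subgroups are equal" (arithmetic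
estrangement + commensurable terminality, cf. `map_branch_eq_of_le_of_hosts_eq` in the geometric case):
`exists_eq_inf_of_isEdgeLike`. Also: `not_isEdgeLike_of_isVerticial_of_geometric` — "no verticial
subgroup is edge-like" (`hVE`) from the typed second sentence of Rmk 5.3.1 (`IntersectionWithGeometricStatement`)
and the geometric fact that no geometric verticial subgroup is geometric edge-like (the route of record);
and `not_isEdgeLike_of_isVerticial` — the same from the incomparability of verticial subgroups and three
data-level inputs (branch groups
proper in their vertex groups; branch groups along one edge conjugate; every edge abuts to a vertex —
the author's Comments (May 2020) item (9) on Def. 5.1 (iv)). Pure group theory over Mathlib; nothing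
here asserts an input for any data, and nothing bears on [IUTchIII] Cor. 3.12.
-/

namespace Literature.AnabelianGeometry.SemiGraphs

universe u u' w w'

variable {Gtp : Type u} [Group Gtp] [TopologicalSpace Gtp]
variable {PA : Type u'} [Group PA] [TopologicalSpace PA]
variable {V : Type w} {B : Type w'}
variable {D : DecompositionData Gtp V B} {aug : Gtp →* PA}

/-! ### Conjugation bookkeeping -/

omit [TopologicalSpace Gtp] in
/-- Iterated conjugation: `g · (h · K · h⁻¹) · g⁻¹ = (gh) · K · (gh)⁻¹`.
[cite: MochizukiSemiAnbd2006, §0, p. 5] -/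
theorem conjSubgroup_conjSubgroup (g h : Gtp) (K : Subgroup Gtp) :
    conjSubgroup g (conjSubgroup h K) = conjSubgroup (g * h) K := by
  simp only [conjSubgroup, Subgroup.map_map]
  congr 1
  ext x
  simp [MulAut.conj_apply, mul_assoc]

omit [TopologicalSpace Gtp] in
/-- Conjugation by a fixed element is injective on subgroups. [cite: MochizukiSemiAnbd2006, §0, p. 5] -/
theorem conjSubgroup_injective (g : Gtp) : Function.Injective (conjSubgroup (Gtp := Gtp) g) :=
  fun _ _ h => Subgroup.map_injective (MulAut.conj g).injective h

omit [TopologicalSpace Gtp] in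
/-- Conjugation by a fixed element is monotone on subgroups. [cite: MochizukiSemiAnbd2006, §0, p. 5] -/
theorem conjSubgroup_mono (g : Gtp) {K K' : Subgroup Gtp} (h : K ≤ K') :
    conjSubgroup g K ≤ conjSubgroup g K' :=
  Subgroup.map_mono h

/-! ### T54-4b: every edge-like subgroup is the intersection of two distinct verticial subgroups -/

/-- **Thm 5.4 (ii), second sentence — the input `hEV` of `arithMaximalCompactStatementII_of` REDUCED**
(arithmetic twin of `EdgeLikeIsInfVerticial` / `edgeLikeIsInfVerticial_of`): if every edge-like subgroup
lies in two distinct verticial subgroups (`hβ₁`) and nested edge-like subgroups are equal (`hβ₂`), then,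
by Thm 5.4 (i) and the first sentence of Rmk 5.3.1, every edge-like subgroup `K` IS `W₁ ⊓ W₂` for two
distinct verticial `W₁, W₂`: `K` is compact and arithmetically ample, so by (i) the intersection
`W₁ ⊓ W₂ ⊇ K` of its two hosts is edge-like, whence equal to `K`.
[cite: MochizukiSemiAnbd2006, Thm 5.4 (ii), p. 66] -/
theorem exists_eq_inf_of_isEdgeLike (hI : ArithMaximalCompactStatementI D aug)
    (hR : VerticialEdgeLikeCompactAmpleStatement D aug)
    (hβ₁ : ∀ K : Subgroup Gtp, IsEdgeLike D K →
      ∃ W₁ W₂ : Subgroup Gtp, IsVerticial D W₁ ∧ IsVerticial D W₂ ∧ W₁ ≠ W₂ ∧ K ≤ W₁ ∧ K ≤ W₂)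
    (hβ₂ : ∀ E E' : Subgroup Gtp, IsEdgeLike D E → IsEdgeLike D E' → E ≤ E' → E = E')
    {K : Subgroup Gtp} (hK : IsEdgeLike D K) :
    ∃ W₁ W₂ : Subgroup Gtp, IsVerticial D W₁ ∧ IsVerticial D W₂ ∧ W₁ ≠ W₂ ∧ K = W₁ ⊓ W₂ := by
  obtain ⟨W₁, W₂, hW₁, hW₂, hne, hK₁, hK₂⟩ := hβ₁ K hK
  obtain ⟨hKc, hKa⟩ := hR K (Or.inr hK)
  obtain ⟨-, h2⟩ := hI K hKc hKa
  obtain ⟨-, hedge⟩ := h2 W₁ W₂ hW₁ hW₂ hne hK₁ hK₂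
  exact ⟨W₁, W₂, hW₁, hW₂, hne, hβ₂ K (W₁ ⊓ W₂) hK hedge (le_inf hK₁ hK₂)⟩

/-! ### No verticial subgroup is edge-like -/

omit [TopologicalSpace Gtp] [TopologicalSpace PA] in
/-- **Input `hVE` — the route of record** (Rmk 5.3.1, second sentence, p. 65: "the intersection with
`Π^temp_𝔾` of a verticial (resp. edge-like) subgroup of `Π^temp_𝔊` is a verticial (resp. edge-like) subgroup
of `Π^temp_𝔾` in the sense of Theorem 3.7"): if the typed second sentence of Rmk 5.3.1 holds for geometric
predicates `IsGeomVerticial`, `IsGeomEdgeLike` under which no geometric verticial subgroup is geometric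
edge-like (Thm 3.7 (ii)–(iv): an edge-like subgroup has infinite index in a verticial one), then no verticial
subgroup of `Π^temp_𝔊` is edge-like. [cite: MochizukiSemiAnbd2006, Rmk 5.3.1, p. 65] -/
theorem not_isEdgeLike_of_isVerticial_of_geometric {IsGeomVerticial IsGeomEdgeLike : Subgroup Gtp → Prop}
    (hgeo : IntersectionWithGeometricStatement D aug IsGeomVerticial IsGeomEdgeLike)
    (hne : ∀ K : Subgroup Gtp, IsGeomVerticial K → ¬ IsGeomEdgeLike K)
    {K : Subgroup Gtp} (hK : IsVerticial D K) : ¬ IsEdgeLike D K :=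
  fun hE => hne _ (hgeo.1 K hK) (hgeo.2 K hE)


omit [TopologicalSpace Gtp] in
/-- **Input `hVE`, alternative route**: if verticial subgroups are pairwise
incomparable (`hinc`), every branch decomposition group is a PROPER subgroup of the decomposition group
of the vertex it abuts to (`hγ`), the decomposition groups of the branches of one edge are conjugate
(`hconj`: both are "`Π^temp_{𝔊,e}`, well-defined up to conjugation", p. 65), and every edge abuts to at
least one vertex (`habuts`: the author's Comments (May 2020), item (9) on Def. 5.1 (iv)), then no
verticial subgroup is edge-like: were `g·Π_v·g⁻¹ = g'·Π_{b'}·g'⁻¹`, moving `b'` along its edge to a branch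
`b` abutting to `u` gives `g·Π_v·g⁻¹ = k·Π_b·k⁻¹ ≤ k·Π_u·k⁻¹`, equality by `hinc`, so `Π_b = Π_u`.
[cite: MochizukiSemiAnbd2006, Thm 5.4 (ii), p. 66] -/
theorem not_isEdgeLike_of_isVerticial
    (hinc : ∀ W W' : Subgroup Gtp, IsVerticial D W → IsVerticial D W' → W ≤ W' → W = W')
    (hγ : ∀ (b : B) (v : V), D.abut b = some v → D.brGp b ≠ D.vertGp v)
    (hconj : ∀ b b' : B, D.edgeOf b = D.edgeOf b' → ∃ h : Gtp, D.brGp b' = conjSubgroup h (D.brGp b))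
    (habuts : ∀ e : D.E, ∃ (b : B) (v : V), D.edgeOf b = e ∧ D.abut b = some v)
    {K : Subgroup Gtp} (hK : IsVerticial D K) : ¬ IsEdgeLike D K := by
  rintro ⟨b', g', hKb'⟩
  obtain ⟨b, u, hbe, hbu⟩ := habuts (D.edgeOf b')
  obtain ⟨h, hh⟩ := hconj b b' hbe
  have hKb : K = conjSubgroup (g' * h) (D.brGp b) := by
    rw [hKb', hh, conjSubgroup_conjSubgroup]
  have hle : K ≤ conjSubgroup (g' * h) (D.vertGp u) :=
    hKb ▸ conjSubgroup_mono (g' * h) (D.brGp_le_vertGp b u hbu)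
  have hW : IsVerticial D (conjSubgroup (g' * h) (D.vertGp u)) := ⟨u, g' * h, rfl⟩
  have heq := hinc K _ hK hW hle
  rw [hKb] at heq
  exact hγ b u hbu (conjSubgroup_injective (g' * h) heq)

omit [TopologicalSpace Gtp] in
/-- The incomparability of verticial subgroups together with the three data-level inputs of
`not_isEdgeLike_of_isVerticial` also yields the STRICT containment of every edge-like subgroup in each
of its verticial hosts: an edge-like `K ≤ W` with `W` verticial is `≠ W`.
[cite: MochizukiSemiAnbd2006, Thm 5.4 (ii), p. 66] -/
theorem ne_of_isEdgeLike_of_isVerticial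
    (hinc : ∀ W W' : Subgroup Gtp, IsVerticial D W → IsVerticial D W' → W ≤ W' → W = W')
    (hγ : ∀ (b : B) (v : V), D.abut b = some v → D.brGp b ≠ D.vertGp v)
    (hconj : ∀ b b' : B, D.edgeOf b = D.edgeOf b' → ∃ h : Gtp, D.brGp b' = conjSubgroup h (D.brGp b))
    (habuts : ∀ e : D.E, ∃ (b : B) (v : V), D.edgeOf b = e ∧ D.abut b = some v)
    {K W : Subgroup Gtp} (hK : IsEdgeLike D K) (hW : IsVerticial D W) : K ≠ W := by
  rintro rfl
  exact not_isEdgeLike_of_isVerticial hinc hγ hconj habuts hW hK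

end Literature.AnabelianGeometry.SemiGraphs
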